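import Summits.Ventures.YMGap.RobustBall.ErgodicAverages
import Summits.Ventures.YMGap.RobustBall.SpecificHeatFloor
import Summits.Ventures.YMGap.RobustBall.WilsonOneStateSymmetry
import Summits.Ventures.YMGap.RobustBall.ThermodynamicVariance
import HarnessLib

/-!
# Venture YMGap, track ROBUST-BALL — «C-SING»: THE YANG–MILLS STATES AT TWO DIFFERENT COUPLINGS ARE MUTUALLY SINGULAR
# (`SU(2)` on `ℤ⁴`, tree couplings in `(0, 9/50)`; every `SU(N)` on `ℤ^d` on the 't Hooft single-link window)

HONEST FRAMING. WHAT THIS IS: a venture file (cell `pub-ymgap`, track Y2 ROBUST-BALL / DS, seat ds-3, theorems only, 0 compute): the infinite-volume DLR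
states of strong-coupling lattice Yang–Mills at two different couplings live on DISJOINT sets of configurations (`μ_{b₁} ⟂ₘ μ_{b₂}`, Mathlib
`MeasureTheory.Measure.MutuallySingular`). Mechanism: the almost-sure ergodic theorem along cubes for the plaquette (`ErgodicAverages.ae_tendsto_boxAverage`:
the empirical mean plaquette of a single sample converges to `u(b)` with probability one) and the STRICT monotonicity of the mean plaquette in the coupling
(`EnergyVariance.su2_plaquette_increment_ge` / `plaquette_increment_ge_dim_thooft`, from the strong convexity of the free energy): the empirical mean
plaquette separates the two states.
* `mutuallySingular_of_ae_tendsto` — generic: two measures under which one sequence of functions converges almost surely to two different constants are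
  mutually singular;
* ★★★ `su2_states_mutuallySingular` — `SU(2)`, `d = 4`, tree couplings `0 < b₁ < b₂ < 9/50` (Wilson `(0, 9/25)`): `μ₁ ⟂ₘ μ₂` for all DLR states
  `μ₁ ∈ 𝒢(b₁)`, `μ₂ ∈ 𝒢(b₂)`; `su2_states_mutuallySingular_of_ne` — the same for `b₁ ≠ b₂` in `(0, 9/50)`;
* ★★ `suN_oneState_translationInvariant_summable` — every `N ≥ 2`, `d ≥ 2`, sharp window `|β| < 1/(8d)`: THE state is translation invariant and the
  plaquette autocovariance is absolutely summable (so the ergodic theorems of `ErgodicAverages` apply);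
* ★★★ `suN_states_mutuallySingular_dim` — every `N ≥ 2`, `d ≥ 2`, 't Hooft couplings `0 < β₁ < β₂` with `β₂ < 1/(12(d−1))`, `β₂ < 1/(8d)`:
  `μ₁ ⟂ₘ μ₂` for the DLR states at the tree couplings `Nβ₁`, `Nβ₂` — HYPOTHESIS-FREE.
WHAT THIS IS NOT: lattice strong coupling; nothing about larger couplings, the continuum limit or Clay. Everything here is proved. [folklore]
-/

noncomputable section

open MeasureTheory ProbabilityTheory Filter Topology Real Finset Set
open scoped NNReal ENNReal
open Literature.Probability.LatticeModels hiding configShift configShift_apply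
open Literature.MathematicalPhysics.QuantumLattice
open Literature.MathematicalPhysics.QuantumFieldTheory (zdPlaquetteObs)

namespace Summit.Ventures.YMGap.RobustBall

namespace BoundaryFreeEnergy

/-! ### Generic: almost-sure limits separate measures -/

/-- **Two measures under which one sequence of functions converges almost surely to two different constants are mutually singular.** [folklore] -/
theorem mutuallySingular_of_ae_tendsto {Ω : Type*} [MeasurableSpace Ω] {μ ν : Measure Ω} (g : ℕ → Ω → ℝ) {a b : ℝ} (hab : a ≠ b)
    (hμ : ∀ᵐ x ∂μ, Tendsto (fun n => g n x) atTop (𝓝 a)) (hν : ∀ᵐ x ∂ν, Tendsto (fun n => g n x) atTop (𝓝 b)) : μ ⟂ₘ ν :=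
  Measure.MutuallySingular.mk (ae_iff.1 hμ) (ae_iff.1 hν) fun x _ => by
    by_contra h
    simp only [Set.mem_union, Set.mem_setOf_eq, not_or, not_not] at h
    exact hab (tendsto_nhds_unique h.1 h.2)

/-! ### `SU(2)` on `ℤ⁴`, tree couplings in `(0, 9/50)` -/

section SU2

/-- ★★★ **THE `SU(2)` YANG–MILLS STATES AT TWO DIFFERENT COUPLINGS ARE MUTUALLY SINGULAR** (`d = 4`, tree couplings `0 < b₁ < b₂ < 9/50`; `μ₁`, `μ₂`
any DLR states at `b₁`, `b₂` — each unique): `μ₁ ⟂ₘ μ₂` — there is a set of configurations of full `μ₁`-measure and zero `μ₂`-measure (the configurations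
whose empirical mean plaquette along cubes converges to `u(b₁) ≠ u(b₂)`). [folklore] -/
theorem su2_states_mutuallySingular {b₁ b₂ : ℝ} (h1 : 0 < b₁) (h12 : b₁ < b₂) (h2 : b₂ < 9 / 50)
    {μ₁ μ₂ : Measure (LGConfig 4 (SUN 2))} (hμ₁ : μ₁ ∈ ymGibbsMeasures (d := 4) (fundamentalRep (Fin 2)) b₁)
    (hμ₂ : μ₂ ∈ ymGibbsMeasures (d := 4) (fundamentalRep (Fin 2)) b₂) : μ₁ ⟂ₘ μ₂ := by
  have hρc : Continuous (fundamentalRep (Fin 2)) := continuous_fundamentalRep (Fin 2)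
  set F : LGConfig 4 (SUN 2) → ℝ := plaquetteObs (fundamentalRep (Fin 2)) 0 0 1 with hF
  have hloc : IsLocalObservable F := ⟨_, isCylinder_plaquetteObs_zero (fundamentalRep (Fin 2)) 0 1⟩
  have hFm : Measurable F := measurable_plaquetteObs _ hρc 0 0 1
  have hFb : ∃ C, ∀ U, |F U| ≤ C := ⟨2, fun U => by simpa using abs_plaquetteObs_le_holds (fundamentalRep (Fin 2)) fundamentalRep_mem_unitaryGroup 0 0 1 U⟩
  have hFg : IsZdGaugeInvariant F := isZdGaugeInvariant_plaquetteObs (fundamentalRep (Fin 2)) 0 0 1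
  -- almost-sure self-averaging under both states
  have hae : ∀ {b : ℝ} {μ : Measure (LGConfig 4 (SUN 2))}, |b| ≤ 9 / 50 → μ ∈ ymGibbsMeasures (d := 4) (fundamentalRep (Fin 2)) b →
      ∀ᵐ U ∂μ, Tendsto (fun n : ℕ => (∑ x ∈ siteBox 4 n, F (configShift x U)) / (siteBox 4 n).card) atTop (𝓝 (∫ U', F U' ∂μ)) := by
    intro b μ hb hμ
    obtain ⟨ν, hν1, hν⟩ := ErgodicAverages.su2_wilson_ae_tendsto_boxAverage hb
    have hμν : μ = ν := by rw [hν1] at hμ; exact Set.mem_singleton_iff.1 hμ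
    rw [hμν]
    exact (hν F hloc hFm hFb hFg).1
  have ha₁ := hae (b := b₁) (abs_le.2 ⟨by linarith, by linarith⟩) hμ₁
  have ha₂ := hae (b := b₂) (abs_le.2 ⟨by linarith, by linarith⟩) hμ₂
  -- the two limits differ: the mean plaquette is strictly increasing in the coupling
  have hinc := EnergyVariance.su2_plaquette_increment_ge h1 h12 h2 hμ₁ hμ₂
  have hpos : 0 < Real.exp (-(48 * b₂)) / 24 * (b₂ - b₁) := mul_pos (by positivity) (sub_pos.2 h12)
  have e₁ : ∫ U, F U ∂μ₁ = 2 * ∫ U, zdPlaquetteObs (fundamentalRep (Fin 2)) 0 0 1 U ∂μ₁ := by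
    simpa using PressureRegularity.integral_plaquetteObs_eq_mul (((0 : Site 4), ⟨((0 : Fin 4), (1 : Fin 4)), by decide⟩) : ZdPlaquette 4) μ₁
  have e₂ : ∫ U, F U ∂μ₂ = 2 * ∫ U, zdPlaquetteObs (fundamentalRep (Fin 2)) 0 0 1 U ∂μ₂ := by
    simpa using PressureRegularity.integral_plaquetteObs_eq_mul (((0 : Site 4), ⟨((0 : Fin 4), (1 : Fin 4)), by decide⟩) : ZdPlaquette 4) μ₂
  have hne : ∫ U, F U ∂μ₁ ≠ ∫ U, F U ∂μ₂ := by
    rw [e₁, e₂]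
    intro h
    linarith
  exact mutuallySingular_of_ae_tendsto _ hne ha₁ ha₂

/-- ★★★ **Mutual singularity for any two different couplings in `(0, 9/50)`** (`SU(2)`, `d = 4`). [folklore] -/
theorem su2_states_mutuallySingular_of_ne {b₁ b₂ : ℝ} (hb₁ : b₁ ∈ Set.Ioo (0 : ℝ) (9 / 50)) (hb₂ : b₂ ∈ Set.Ioo (0 : ℝ) (9 / 50)) (hne : b₁ ≠ b₂)
    {μ₁ μ₂ : Measure (LGConfig 4 (SUN 2))} (hμ₁ : μ₁ ∈ ymGibbsMeasures (d := 4) (fundamentalRep (Fin 2)) b₁)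
    (hμ₂ : μ₂ ∈ ymGibbsMeasures (d := 4) (fundamentalRep (Fin 2)) b₂) : μ₁ ⟂ₘ μ₂ := by
  rcases lt_or_gt_of_ne hne with h | h
  · exact su2_states_mutuallySingular hb₁.1 h hb₂.2 hμ₁ hμ₂
  · exact (su2_states_mutuallySingular hb₂.1 h hb₁.2 hμ₂ hμ₁).symm

end SU2

/-! ### Every `SU(N)`, every `d ≥ 2` -/

section SUN

variable {d N : ℕ}

/-- ★★ **THE STATE IS TRANSLATION INVARIANT WITH ABSOLUTELY SUMMABLE PLAQUETTE AUTOCOVARIANCE, EVERY `N ≥ 2`, EVERY `d ≥ 2`** (sharp window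
`|β| < 1/(8d)`, `μ` THE DLR state at `Nβ`, plane `(i, j)`): the hypotheses of the ergodic theorems of `ErgodicAverages` hold (`MassGapAt d N β` ⇒ exponential
decay of the autocovariance ⇒ summable). [folklore] -/
theorem suN_oneState_translationInvariant_summable [NeZero d] (hd : 2 ≤ d) (hN : 2 ≤ N) {β : ℝ}
    (hβs : |β| < HessianSharp.sharpThresholdSU d) {μ : Measure (LGConfig d (SUN N))}
    (hμ : μ ∈ ymGibbsMeasures (d := d) (fundamentalRep (Fin N)) (N * β)) (i j : Fin d) :
    IsZdTranslationInvariant μ ∧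
      Summable fun v : Site d => |cov[plaquetteObs (fundamentalRep (Fin N)) 0 i j,
        fun U => plaquetteObs (fundamentalRep (Fin N)) 0 i j (configShift v U); μ]| := by
  haveI : SecondCountableTopology (Matrix.specialUnitaryGroup (Fin N) ℂ) :=
    haveI : SecondCountableTopology (Matrix (Fin N) (Fin N) ℂ) := inferInstanceAs (SecondCountableTopology (Fin N → Fin N → ℂ))
    Topology.IsEmbedding.subtypeVal.secondCountableTopology
  have hρc : Continuous (fundamentalRep (Fin N)) := continuous_fundamentalRep (Fin N)
  have hG : IsGibbsMeasure (ymSpecification (d := d) (fundamentalRep (Fin N)) (N * β)) μ := hμ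
  haveI := hG.isProbabilityMeasure
  obtain ⟨ν, h1, -, hinv, -⟩ := suN_wilson_oneState_symmetric_sharp hd hN hβs
  have hμν : μ = ν := by rw [h1] at hμ; exact Set.mem_singleton_iff.1 hμ
  rw [← hμν] at hinv
  set F : LGConfig d (SUN N) → ℝ := plaquetteObs (fundamentalRep (Fin N)) 0 i j with hF
  have hloc : IsLocalObservable F := ⟨_, isCylinder_plaquetteObs_zero (fundamentalRep (Fin N)) i j⟩
  have hFm : Measurable F := measurable_plaquetteObs _ hρc 0 i j
  have hFb : ∀ U, |F U| ≤ N := fun U => abs_plaquetteObs_le_holds (fundamentalRep (Fin N)) fundamentalRep_mem_unitaryGroup 0 i j U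
  obtain ⟨c, hc, hcl⟩ := (SharpUniquenessJoin.massGapAt_sharp_free hd hN hβs).2 μ hμ
  obtain ⟨C₀, hC₀⟩ := MassGapMassive.covariance_decay_of_lipschitzClustering (by omega) (by omega) (N * β) hμ hc hcl F F hloc hloc hFm hFm
    ⟨N, hFb⟩ ⟨N, hFb⟩
  exact ⟨hinv, ThermodynamicVariance.summable_abs_of_exp_decay (by omega) hc hC₀⟩

/-- ★★★ **THE `SU(N)` YANG–MILLS STATES AT TWO DIFFERENT COUPLINGS ARE MUTUALLY SINGULAR, EVERY `N ≥ 2`, EVERY `d ≥ 2`** ('t Hooft couplings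
`0 < β₁ < β₂` with `β₂ < 1/(12(d−1))` and `β₂ < 1/(8d)`; `μ₁`, `μ₂` any DLR states at the tree couplings `Nβ₁`, `Nβ₂` — each unique): `μ₁ ⟂ₘ μ₂` —
HYPOTHESIS-FREE. [folklore] -/
theorem suN_states_mutuallySingular_dim [NeZero d] (hd : 2 ≤ d) (hN : 2 ≤ N) {β₁ β₂ : ℝ} (h1 : 0 < β₁) (h12 : β₁ < β₂)
    (h2 : β₂ < 1 / (12 * ((d : ℝ) - 1))) (h2' : β₂ < 1 / (8 * (d : ℝ)))
    {μ₁ μ₂ : Measure (LGConfig d (SUN N))} (hμ₁ : μ₁ ∈ ymGibbsMeasures (d := d) (fundamentalRep (Fin N)) (N * β₁))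
    (hμ₂ : μ₂ ∈ ymGibbsMeasures (d := d) (fundamentalRep (Fin N)) (N * β₂)) : μ₁ ⟂ₘ μ₂ := by
  haveI : SecondCountableTopology (Matrix.specialUnitaryGroup (Fin N) ℂ) :=
    haveI : SecondCountableTopology (Matrix (Fin N) (Fin N) ℂ) := inferInstanceAs (SecondCountableTopology (Fin N → Fin N → ℂ))
    Topology.IsEmbedding.subtypeVal.secondCountableTopology
  have hρc : Continuous (fundamentalRep (Fin N)) := continuous_fundamentalRep (Fin N)
  have hG₁ : IsGibbsMeasure (ymSpecification (d := d) (fundamentalRep (Fin N)) (N * β₁)) μ₁ := hμ₁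
  have hG₂ : IsGibbsMeasure (ymSpecification (d := d) (fundamentalRep (Fin N)) (N * β₂)) μ₂ := hμ₂
  haveI := hG₁.isProbabilityMeasure
  haveI := hG₂.isProbabilityMeasure
  have hβ1s : |β₁| < HessianSharp.sharpThresholdSU d := by
    rw [abs_of_nonneg h1.le]; exact lt_trans h12 h2'
  have hβ2s : |β₂| < HessianSharp.sharpThresholdSU d := by rw [abs_of_nonneg (h1.le.trans h12.le)]; exact h2'
  set i0 : Fin d := ⟨0, by omega⟩ with hi0
  set j1 : Fin d := ⟨1, by omega⟩ with hj1
  set F : LGConfig d (SUN N) → ℝ := plaquetteObs (fundamentalRep (Fin N)) 0 i0 j1 with hF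
  have hFm : Measurable F := measurable_plaquetteObs _ hρc 0 i0 j1
  have hFb : ∀ U, |F U| ≤ N := fun U => abs_plaquetteObs_le_holds (fundamentalRep (Fin N)) fundamentalRep_mem_unitaryGroup 0 i0 j1 U
  -- almost-sure self-averaging under both states
  obtain ⟨hinv₁, hs₁⟩ := suN_oneState_translationInvariant_summable hd hN hβ1s hμ₁ i0 j1
  obtain ⟨hinv₂, hs₂⟩ := suN_oneState_translationInvariant_summable hd hN hβ2s hμ₂ i0 j1
  have ha₁ := ErgodicAverages.ae_tendsto_boxAverage hd hinv₁ hFm hFb hs₁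
  have ha₂ := ErgodicAverages.ae_tendsto_boxAverage hd hinv₂ hFm hFb hs₂
  -- the two limits differ: the mean plaquette is strictly increasing in the coupling
  have hN0 : (0 : ℝ) < N := by exact_mod_cast (show 0 < N by omega)
  have hd1 : (0 : ℝ) < 12 * ((d : ℝ) - 1) := by
    have : (2 : ℝ) ≤ d := by exact_mod_cast hd
    linarith
  have hb2 : (N : ℝ) * β₂ < (N : ℝ) / (12 * ((d : ℝ) - 1)) := by
    rw [lt_div_iff₀ hd1]
    have := (lt_div_iff₀ hd1).1 h2
    nlinarith
  have hinc := EnergyVariance.plaquette_increment_ge_dim_thooft hd hN (mul_pos hN0 h1) (mul_lt_mul_of_pos_left h12 hN0) hb2 hμ₁ hμ₂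
  have hV : 0 < Literature.MathematicalPhysics.QuantumFieldTheory.PlaquetteLowerBound.charVariance (fundamentalRep (Fin N)) :=
    Literature.MathematicalPhysics.QuantumFieldTheory.PlaquetteLowerBound.charVariance_pos _ hρc (by omega)
  have hpos : 0 < (1 / 2 : ℝ) * Real.exp (-(8 * (d - 1 : ℕ) * N * (N * β₂))) *
      Literature.MathematicalPhysics.QuantumFieldTheory.PlaquetteLowerBound.charVariance (fundamentalRep (Fin N)) * (N * β₂ - N * β₁) := by
    have : 0 < (N : ℝ) * β₂ - N * β₁ := by nlinarith
    positivity
  have e₁ : ∫ U, F U ∂μ₁ = N * ∫ U, zdPlaquetteObs (fundamentalRep (Fin N)) 0 i0 j1 U ∂μ₁ :=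
    PressureRegularity.integral_plaquetteObs_eq_mul (((0 : Site d), ⟨(i0, j1), by simp [hi0, hj1, Fin.lt_def]⟩) : ZdPlaquette d) μ₁
  have e₂ : ∫ U, F U ∂μ₂ = N * ∫ U, zdPlaquetteObs (fundamentalRep (Fin N)) 0 i0 j1 U ∂μ₂ :=
    PressureRegularity.integral_plaquetteObs_eq_mul (((0 : Site d), ⟨(i0, j1), by simp [hi0, hj1, Fin.lt_def]⟩) : ZdPlaquette d) μ₂
  have hplpos : (0 : ℝ) < Fintype.card {q : Fin d × Fin d // q.1 < q.2} := by
    have : Nonempty {q : Fin d × Fin d // q.1 < q.2} := ⟨⟨(i0, j1), by simp [hi0, hj1, Fin.lt_def]⟩⟩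
    exact_mod_cast Fintype.card_pos
  have hne : ∫ U, F U ∂μ₁ ≠ ∫ U, F U ∂μ₂ := by
    rw [e₁, e₂]
    intro h
    have h0 : ∫ U, zdPlaquetteObs (fundamentalRep (Fin N)) 0 i0 j1 U ∂μ₁ = ∫ U, zdPlaquetteObs (fundamentalRep (Fin N)) 0 i0 j1 U ∂μ₂ := by
      have := mul_left_cancel₀ hN0.ne' h
      exact this
    rw [h0, sub_self, mul_zero] at hinc
    linarith
  exact mutuallySingular_of_ae_tendsto _ hne ha₁ ha₂

end SUN

end BoundaryFreeEnergy

end Summit.Ventures.YMGap.RobustBall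

end
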